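import Literature.Topology.FourManifolds.ReducibleTrisectionSeparatingSides
import Literature.Topology.FourManifolds.TrisectionFunctorGKInputs
import Literature.Topology.FourManifolds.SmoothOrientationProofs
import HarnessLib

/-!
# A separating reducing curve has separating compressing discs

Topic `Literature/Topology/FourManifolds`; the second proved step (after
`ReducibleTrisectionSeparatingSides.lean`) on the road to the named fact
`Literature.Topology.FourManifolds.Trisection.isConnectedSum_of_reducing_separating`
(Aranda–Zupan, arXiv:2503.04607 §2 p. 6; printed proof Meier–Schirmer–Zupan 2016 §3, Prop. 3.5
and proof of Prop. 3.9): step (P3) of `ReducibleTrisectionSplitting.lean`, `§ Status of the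
separating fact` — *if the reducing curve `δ` separates the central surface `F`, then each
compressing disc `D_q` separates its handlebody `H_q`* (so that `H_q` cut along `D_q` has the two
pieces which become the handlebodies of the two summands).  **Everything here is proved; no
definitions, no named facts.**

The disc enters through the interface of the non-separating companion
(`IsGKTrisection.not_simplyConnectedSpace_of_sideFunctions` / `…_of_sideCharts`,
`ReducibleTrisectionNonSeparatingPi1{,Charts}.lean`): a closed `D` with `D ∩ F = δ`, an
open `O ⊇ D` with a **side function** `σ = ±1` on `(O ∩ H_q) ∖ D`, locally constant relative to
`H_q`, and **flat charts** of `(F, δ)` in which the two local sides of `δ` in `F` carry opposite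
signs of `σ`.

**Theorem (`IsGKTrisection.not_isConnected_spineHandlebody_diff_of_sideCharts`).**  Under these
hypotheses, if `δ` is separating on `F` (`¬ Trisection.IsNonSeparating S δ`) then `H_q ∖ D` is
not connected.

**Proof.**  Suppose `H_q ∖ D` connected.  As in the companion, metrise `X`, let
`K = σ · infDist(·, D)` (a continuous normal coordinate of `D` on `O ∩ H_q`) and
`Θ = circleCollapse K ρ : H_q → ℝ/ℤ` for a cut-off `ρ`.  A short arc `α` in `F` crossing `δ` once
in a flat chart, closed up by a return path in `H_q ∖ D` (which is path connected: `H_q` is a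
manifold with boundary, hence locally path connected, `IsGKTrisection.locallyPathConnectedSpace_spineHandlebody`),
is a loop on which the winding character `wind ∘ Θ⁎` of `π₁(H_q)` is non-trivial
(`windingHom_circleCollapse_ne_one_of_arc_of_path`).  Since `π₁(F) → π₁(H_q)` is onto
(`IsGKTrisection.surjective_inclHomOfSubset_handlebody`), the winding character of the trace
`c = Θ|F` is non-trivial too.  But `δ` separates `F` into two sides `F₁ ⊔ F₂`
(`IsGKTrisection.exists_two_sides_of_not_isNonSeparating`), and in the flat charts one local
side of `δ` lies in `F₁` and the other in `F₂`; so `σ|F = κ · χ` near `δ` with `χ = ±1` the side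
indicator and one sign `κ` (`exists_open_forall_eq_of_local` along the connected `δ`).  Hence on
`F` the normal coordinate `K` has the sign of `κ · K̃`, `K̃ = χ · infDist(·, D)`, which is
continuous on ALL of `F`; the two collapses have winding characters with the same kernel
(`ker_windingHom_circleCollapse_eq`), and a collapse whose normal coordinate is globally
continuous has a global real lift, hence trivial winding character
(`windingHom_circleCollapseMap_eq_one_of_continuous`) — a contradiction.

* `exists_continuous_lift_circleCollapse`, `windingHom_circleCollapseMap_eq_one_of_continuous`
  — general topology (`ρ ≥ 0`): a global real lift of `circleCollapse K ρ` for `K` continuous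
  everywhere, and the triviality of its winding character.
* `IsGKTrisection.locallyPathConnectedSpace_spineHandlebody` — `H_q` is locally path connected.
* `IsGKTrisection.exists_sideIndicator` — the side indicator `χ` of a separating curve and the
  relation `σ = κ χ` near `δ` on `F`.
* `IsGKTrisection.not_isConnected_spineHandlebody_diff_of_sideCharts` — the theorem.

## References

* R. Aranda, A. Zupan, *Manifolds with weakly reducible genus-three trisections are standard*,
  arXiv:2503.04607 (2025), §2 p. 6 (reducing curves; the separating case). [ArandaZupan2025]
* J. Meier, T. Schirmer, A. Zupan, *Classification of trisections and the Generalized Property R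
  Conjecture*, Proc. AMS 144 (2016), §3, Prop. 3.5 and proof of Prop. 3.9. [MeierSchirmerZupan2016]
* A. Hatcher, *Algebraic Topology*, CUP (2002), Thm. 1.7 (p. 29). [HatcherAT2002]
-/

noncomputable section

open Set Function Filter Topology Metric
open scoped Manifold ContDiff unitInterval

namespace Literature.Topology.FourManifolds

open Literature.AlgebraicTopology Literature.AlgebraicTopology.FundamentalGroup
  Literature.AlgebraicTopology.FundamentalGroup.VanKampen

universe u

/-! ### A collapse with a globally continuous normal coordinate has trivial winding character -/

section GlobalLift

variable {Y : Type*} [TopologicalSpace Y]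

/-- **Global real lift of a collapse.**  If the normal coordinate `K` is continuous on all of `Y`
and non-zero off `P`, and the cut-off `ρ ≥ 0` does not vanish on `P`, then `circleCollapse K ρ`
has a continuous real lift: `clampHalf (K / ρ)` where `ρ ≠ 0`, and `sign(K) / 2` where `ρ = 0`
(near such a point `K` keeps its sign and `ρ` is small, so the clamp is saturated). [folklore] -/
theorem exists_continuous_lift_circleCollapse {K ρ : Y → ℝ} {P : Set Y} (hK : Continuous K)
    (hKne : ∀ y, y ∉ P → K y ≠ 0) (hρ : Continuous ρ) (hρ0 : ∀ y, 0 ≤ ρ y)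
    (hρP : ∀ y ∈ P, ρ y ≠ 0) :
    ∃ L : Y → ℝ, Continuous L ∧ ∀ y, ((L y : ℝ) : AddCircle (1 : ℝ)) = circleCollapse K ρ y := by
  classical
  set L : Y → ℝ := fun y =>
    if ρ y = 0 then (if 0 < K y then 2⁻¹ else -2⁻¹) else clampHalf (K y / ρ y) with hL
  refine ⟨L, ?_, ?_⟩
  · rw [continuous_iff_continuousAt]
    intro y₀
    by_cases hρy : ρ y₀ = 0
    · -- `y₀ ∉ P`, `K y₀ ≠ 0`: the lift is locally constant
      have hK0 : K y₀ ≠ 0 := hKne y₀ fun h => hρP y₀ h hρy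
      have hρt : Tendsto ρ (𝓝 y₀) (𝓝 0) := hρy ▸ hρ.continuousAt
      rcases lt_or_gt_of_ne hK0 with hneg | hpos
      · have h1 : ∀ᶠ y in 𝓝 y₀, K y < K y₀ / 2 :=
          hK.continuousAt.eventually (gt_mem_nhds (by linarith))
        have h2 : ∀ᶠ y in 𝓝 y₀, ρ y < -(K y₀) / 2 :=
          hρt.eventually (gt_mem_nhds (by linarith))
        have hev : ∀ᶠ y in 𝓝 y₀, L y = -2⁻¹ := by
          filter_upwards [h1, h2] with y hy1 hy2
          by_cases hρ0' : ρ y = 0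
          · simp only [hL, hρ0', if_true]
            rw [if_neg (by linarith)]
          · simp only [hL, if_neg hρ0']
            have hρpos : 0 < ρ y := lt_of_le_of_ne (hρ0 y) (Ne.symm hρ0')
            refine clampHalf_of_le_neg ?_
            rw [div_le_iff₀ hρpos]
            linarith
        have hLy : L y₀ = -2⁻¹ := hev.self_of_nhds
        exact (continuousAt_const (y := (-2⁻¹ : ℝ))).congr
          (hev.mono fun y hy => hy.symm)
      · have h1 : ∀ᶠ y in 𝓝 y₀, K y₀ / 2 < K y :=
          hK.continuousAt.eventually (lt_mem_nhds (by linarith))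
        have h2 : ∀ᶠ y in 𝓝 y₀, ρ y < K y₀ / 2 :=
          hρt.eventually (gt_mem_nhds (by linarith))
        have hev : ∀ᶠ y in 𝓝 y₀, L y = 2⁻¹ := by
          filter_upwards [h1, h2] with y hy1 hy2
          by_cases hρ0' : ρ y = 0
          · simp only [hL, hρ0', if_true]
            rw [if_pos (by linarith)]
          · simp only [hL, if_neg hρ0']
            have hρpos : 0 < ρ y := lt_of_le_of_ne (hρ0 y) (Ne.symm hρ0')
            refine clampHalf_of_le ?_
            rw [le_div_iff₀ hρpos]
            linarith
        exact (continuousAt_const (y := (2⁻¹ : ℝ))).congr (hev.mono fun y hy => hy.symm)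
    · -- `ρ y₀ ≠ 0`: the formula
      have hev : ∀ᶠ y in 𝓝 y₀, ρ y ≠ 0 := hρ.continuousAt.eventually_ne hρy
      have hf : ContinuousAt (fun y => clampHalf (K y / ρ y)) y₀ :=
        continuous_clampHalf.continuousAt.comp (hK.continuousAt.div hρ.continuousAt hρy)
      refine hf.congr ?_
      filter_upwards [hev] with y hy
      simp only [hL, if_neg hy]
  · intro y
    by_cases hρy : ρ y = 0
    · rw [circleCollapse_of_rho_eq_zero hρy]
      simp only [hL, hρy, if_true]
      split_ifs
      · rfl
      · exact coe_neg_half_eq_coe_half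
    · rw [circleCollapse_of_rho_ne_zero hρy]
      simp only [hL, if_neg hρy]

/-- **A collapse whose normal coordinate is continuous on the whole space has trivial winding
character.**  (With the bundled `circleCollapseMap` of any admissible data `N ⊇ tsupport ρ`:
the map only depends on `K`, `ρ`.)  Every loop lifts through the global real lift, with equal
end values. [cite: HatcherAT2002, Thm. 1.7 (p. 29) and its proof] -/
theorem windingHom_circleCollapseMap_eq_one_of_continuous {K ρ : Y → ℝ} {N P : Set Y}
    (hN : IsOpen N) (hKN : ContinuousOn K N) (hKneN : ∀ y ∈ N, y ∉ P → K y ≠ 0)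
    (hρ : Continuous ρ) (hsupp : tsupport ρ ⊆ N) (hρP : ∀ y ∈ P, ρ y ≠ 0)
    (hK : Continuous K) (hKne : ∀ y, y ∉ P → K y ≠ 0) (hρ0 : ∀ y, 0 ≤ ρ y) (x : Y) :
    (fundamentalGroupAddCircleEquiv one_ne_zero (circleCollapse K ρ x)).toMonoidHom.comp
        (_root_.FundamentalGroup.map (circleCollapseMap hN hKN hKneN hρ hsupp hρP) x) = 1 := by
  obtain ⟨L, hL, hlift⟩ := exists_continuous_lift_circleCollapse hK hKne hρ hρ0 hρP
  set θ := circleCollapseMap hN hKN hKneN hρ hsupp hρP with hθ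
  ext a
  induction a using Quotient.ind with
  | _ γ =>
    have hΛ : Continuous fun t : I => L (γ t) := hL.comp γ.continuous
    have hl : ∀ t : I, ((L (γ t) : ℝ) : AddCircle (1 : ℝ)) = θ (γ t) := fun t => by
      rw [hθ, circleCollapseMap_apply]; exact hlift _
    have hn : (fun t : I => L (γ t)) 1 = (fun t : I => L (γ t)) 0 + ((0 : ℤ) : ℝ) := by
      simp only [γ.source, γ.target, Int.cast_zero, add_zero]
    have := wind_fromPath_eq_of_lift θ γ (fun t => L (γ t)) hΛ hl 0 hn
    rw [ofAdd_zero] at this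
    exact this

end GlobalLift

/-! ### The handlebodies of the spine are locally path connected -/

section Handlebody

variable {X : Type u} [TopologicalSpace X] [ChartedSpace (EuclideanSpace ℝ (Fin 4)) X]
  {g : ℕ} {k : Fin 3 → ℕ} {S : Fin 3 → Set X}

/-- **The handlebody `H_q` of the spine is locally path connected**: it is the image of a
smooth embedding of a compact `3`-manifold with boundary (clause (iii) of `IsGKTrisection`),
which is locally path connected (`locallyPathConnectedSpace_of_modelWithCorners`).
[cite: GayKirby2016, Def. 1] -/
theorem IsGKTrisection.locallyPathConnectedSpace_spineHandlebody (h : IsGKTrisection X g k S)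
    (q : Fin 3) : LocallyPathConnectedSpace ↥(Trisection.spineHandlebody S q) := by
  obtain ⟨H, _, _, f, -, -, -, -, hf, hrange, -⟩ := h.2.2 (q + 1) (q + 2) (fin3_succ_ne q).2.2
  have hL : LocallyPathConnectedSpace H := locallyPathConnectedSpace_of_modelWithCorners (𝓡∂ 3) H
  have e1 : ↥(Trisection.spineHandlebody S q) ≃ₜ ↥(range f) :=
    Homeomorph.setCongr (by rw [hrange, Trisection.spineHandlebody_eq_inter])
  have e2 : H ≃ₜ ↥(range f) := hf.isEmbedding.toHomeomorph
  exact (e1.trans e2.symm).isOpenEmbedding.locallyPathConnectedSpace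

end Handlebody

/-! ### The side indicator of a separating curve -/

section SideIndicator

variable {X : Type u} [TopologicalSpace X] [T2Space X]
  [ChartedSpace (EuclideanSpace ℝ (Fin 4)) X] {g : ℕ} {k : Fin 3 → ℕ} {S : Fin 3 → Set X}

/-- **Local sides from a flat chart, with their half-boxes.**  Variant of
`exists_local_sides_of_flatChart` recording that the two local sides are the preimages of the
half-boxes `{±e₂ > 0}` over a ball, inside `e.source`. [folklore] -/
theorem exists_local_sides_of_flatChart' {Y : Type*} [TopologicalSpace Y] {δ : Set Y} {p : Y}
    (e : OpenPartialHomeomorph Y (ℝ × ℝ)) (hpe : p ∈ e.source) (hep : e p = 0)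
    (hδe : ∀ y ∈ e.source, y ∈ δ ↔ (e y).2 = 0) {A : Set Y} (hA : A ∈ 𝓝 p) :
    ∃ W : Set Y, IsOpen W ∧ p ∈ W ∧ W ⊆ A ∧ W ⊆ e.source ∧
      ∃ P₁ P₂ : Set Y, IsPreconnected P₁ ∧ IsPreconnected P₂ ∧
      P₁ ⊆ δᶜ ∧ P₂ ⊆ δᶜ ∧ W \ δ ⊆ P₁ ∪ P₂ ∧ W ∩ δ ⊆ closure P₁ ∧ W ∩ δ ⊆ closure P₂ ∧
      P₁.Nonempty ∧ P₂.Nonempty ∧ P₁ ⊆ W ∧ P₂ ⊆ W ∧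
      (∀ y ∈ P₁, 0 < (e y).2) ∧ (∀ y ∈ P₂, (e y).2 < 0) := by
  -- a ball in the target over which the chart lands in `A`
  set T : Set (ℝ × ℝ) := e.target ∩ e.symm ⁻¹' (interior A) with hT
  have hTo : IsOpen T := e.continuousOn_symm.isOpen_inter_preimage e.open_target isOpen_interior
  have h0T : (0 : ℝ × ℝ) ∈ T := by
    refine ⟨hep ▸ e.map_source hpe, ?_⟩
    show e.symm 0 ∈ interior A
    rw [← hep, e.left_inv hpe]
    exact mem_interior_iff_mem_nhds.2 hA
  obtain ⟨r, hr, hBT⟩ := Metric.isOpen_iff.1 hTo 0 h0T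
  set B : Set (ℝ × ℝ) := Metric.ball 0 r with hB
  have hBo : IsOpen B := Metric.isOpen_ball
  have hBt : B ⊆ e.target := fun v hv => (hBT hv).1
  set W : Set Y := e.source ∩ e ⁻¹' B with hWdef
  set P₁ : Set Y := e.symm '' (B ∩ {v | 0 < v.2}) with hP₁def
  set P₂ : Set Y := e.symm '' (B ∩ {v | v.2 < 0}) with hP₂def
  have hWo : IsOpen W := e.isOpen_inter_preimage hBo
  have hpW : p ∈ W := ⟨hpe, show e p ∈ B by rw [hep]; exact Metric.mem_ball_self hr⟩
  have hWA : W ⊆ A := fun y hy => by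
    have h1 : e.symm (e y) ∈ interior A := (hBT hy.2).2
    rw [e.left_inv hy.1] at h1
    exact interior_subset h1
  have hsymm_cont : ∀ s ⊆ B, ContinuousOn e.symm s := fun s hs =>
    e.continuousOn_symm.mono (hs.trans hBt)
  have himW : ∀ s : Set (ℝ × ℝ), e.symm '' (B ∩ s) ⊆ W := by
    rintro s _ ⟨v, ⟨hvB, -⟩, rfl⟩
    exact ⟨e.map_target (hBt hvB), show e (e.symm v) ∈ B by rw [e.right_inv (hBt hvB)]; exact hvB⟩
  have hval : ∀ (s : Set (ℝ × ℝ)), ∀ y ∈ e.symm '' (B ∩ s), e y ∈ s := by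
    rintro s _ ⟨v, ⟨hvB, hvs⟩, rfl⟩
    rw [e.right_inv (hBt hvB)]; exact hvs
  -- the half-boxes miss `δ`
  have hPδ : ∀ (s : Set (ℝ × ℝ)), (∀ v ∈ s, v.2 ≠ 0) → e.symm '' (B ∩ s) ⊆ δᶜ := by
    rintro s hs _ ⟨v, ⟨hvB, hvs⟩, rfl⟩ hδ
    have hsrc : e.symm v ∈ e.source := e.map_target (hBt hvB)
    have h0 : (e (e.symm v)).2 = 0 := (hδe _ hsrc).1 hδ
    rw [e.right_inv (hBt hvB)] at h0
    exact hs v hvs h0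
  -- points of `δ` over `B` are limits of each half-box
  have hclos : ∀ (ε : ℝ), (ε = 1 ∨ ε = -1) →
      W ∩ δ ⊆ closure (e.symm '' (B ∩ {v | 0 < ε * v.2})) := by
    rintro ε hε y ⟨⟨hysrc, hyB⟩, hyδ⟩
    have hv2 : (e y).2 = 0 := (hδe y hysrc).1 hyδ
    have hyv : e.symm (e y) = y := e.left_inv hysrc
    have h1 : Tendsto (fun t : ℝ => e y + ((0 : ℝ), ε * t)) (𝓝[>] 0) (𝓝 (e y)) := by
      have hc : Continuous fun t : ℝ => e y + ((0 : ℝ), ε * t) :=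
        continuous_const.add (continuous_const.prodMk (continuous_const.mul continuous_id))
      have := hc.tendsto 0
      simp only [mul_zero, Prod.mk_zero_zero, add_zero] at this
      exact this.mono_left nhdsWithin_le_nhds
    have h2 : Tendsto (fun t : ℝ => e.symm (e y + ((0 : ℝ), ε * t))) (𝓝[>] 0) (𝓝 y) := by
      have := (e.continuousAt_symm (hBt hyB)).tendsto.comp h1
      rwa [hyv] at this
    refine mem_closure_of_tendsto h2 ?_
    have hBev : ∀ᶠ t in 𝓝[>] (0 : ℝ), e y + ((0 : ℝ), ε * t) ∈ B := h1 (hBo.mem_nhds hyB)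
    filter_upwards [hBev, self_mem_nhdsWithin] with t htB ht
    refine ⟨e y + ((0 : ℝ), ε * t), ⟨htB, ?_⟩, rfl⟩
    show 0 < ε * (e y + ((0 : ℝ), ε * t)).2
    have ht' : (0 : ℝ) < t := ht
    rcases hε with h | h <;> simp [h, hv2, ht']
  have hcl₁ : W ∩ δ ⊆ closure P₁ := by simpa only [one_mul] using hclos 1 (Or.inl rfl)
  have hcl₂ : W ∩ δ ⊆ closure P₂ := by
    have := hclos (-1) (Or.inr rfl)
    simpa only [neg_mul, one_mul, Left.neg_pos_iff] using this
  have hpδ : p ∈ δ := (hδe p hpe).2 (by rw [hep]; rfl)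
  refine ⟨W, hWo, hpW, hWA, inter_subset_left, P₁, P₂,
    ((convex_ball _ _).inter convex_snd_pos).isPreconnected.image _ (hsymm_cont _ inter_subset_left),
    ((convex_ball _ _).inter convex_snd_neg).isPreconnected.image _ (hsymm_cont _ inter_subset_left),
    hPδ _ (fun v hv => ne_of_gt hv), hPδ _ (fun v hv => ne_of_lt hv), ?_, hcl₁, hcl₂,
    closure_nonempty_iff.1 ⟨p, hcl₁ ⟨hpW, hpδ⟩⟩, closure_nonempty_iff.1 ⟨p, hcl₂ ⟨hpW, hpδ⟩⟩,
    himW _, himW _, hval {v | 0 < v.2}, hval {v | v.2 < 0}⟩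
  -- `W ∖ δ` is covered by the two half-boxes
  rintro y ⟨⟨hysrc, hyB⟩, hyδ⟩
  have hne : (e y).2 ≠ 0 := fun h0 => hyδ ((hδe y hysrc).2 h0)
  have hyv : e.symm (e y) = y := e.left_inv hysrc
  rcases lt_or_gt_of_ne hne with hlt | hgt
  · exact Or.inr ⟨e y, ⟨hyB, hlt⟩, hyv⟩
  · exact Or.inl ⟨e y, ⟨hyB, hgt⟩, hyv⟩

/-- **The side indicator of a separating curve, and the sign of a side function on `F`.**
Let `δ` be a separating curve on the central surface `F = ⋂ l, S l` of a Gay–Kirby trisection,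
and `σ : F → ℝ` a function which, in flat charts of `(F, δ)` at the points of `δ`, is a constant
`ε = ±1` on the upper half and `-ε` on the lower half.  Then there is `χ : F → ℝ`, equal to `±1`
and locally constant off `δ`, `0` on `δ`, constant on each of the two sides of `δ`
(`IsGKTrisection.exists_two_sides_of_not_isNonSeparating`), and ONE sign `κ = ±1` with
`σ = κ χ` on a neighbourhood of `δ` in `F`, off `δ`.
[cite: ArandaZupan2025, §2 p. 6 (separating reducing curves)] -/
theorem IsGKTrisection.exists_sideIndicator (h : IsGKTrisection X g k S) {δ : Set X}
    (hc : Trisection.IsCurve S δ) (hsep : ¬ Trisection.IsNonSeparating S δ)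
    (sd : ↥(⋂ l, S l) → ℝ)
    (hchart : ∀ p : ↥(⋂ l, S l), (p : X) ∈ δ →
      ∃ e : OpenPartialHomeomorph ↥(⋂ l, S l) (ℝ × ℝ), p ∈ e.source ∧ e p = 0 ∧
        (∀ y ∈ e.source, (y : X) ∈ δ ↔ (e y).2 = 0) ∧
        ∃ ε : ℝ, (ε = 1 ∨ ε = -1) ∧ ∀ y ∈ e.source,
          (0 < (e y).2 → sd y = ε) ∧ ((e y).2 < 0 → sd y = -ε)) :
    ∃ χ : ↥(⋂ l, S l) → ℝ,
      (∀ y : ↥(⋂ l, S l), (y : X) ∉ δ → χ y = 1 ∨ χ y = -1) ∧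
      (∀ y : ↥(⋂ l, S l), (y : X) ∈ δ → χ y = 0) ∧
      (∀ y : ↥(⋂ l, S l), (y : X) ∉ δ → ∀ᶠ z in 𝓝 y, χ z = χ y) ∧
      ∃ A : Set ↥(⋂ l, S l), IsOpen A ∧ Subtype.val ⁻¹' δ ⊆ A ∧ ∃ κ : ℝ, (κ = 1 ∨ κ = -1) ∧
        ∀ y ∈ A, (y : X) ∉ δ → sd y = κ * χ y := by
  classical
  obtain ⟨F₁, F₂, hunion, hdisj, -, -, hF₁o, hF₂o, hcl₁, hcl₂, hmax⟩ :=
    h.exists_two_sides_of_not_isNonSeparating hc hsep fun p hp => by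
      obtain ⟨e, hpe, hep, hδe, -⟩ := hchart p hp
      exact ⟨e, hpe, hep, hδe⟩
  have hδF : δ ⊆ ⋂ l, S l := hc.1
  have hF₁sub : F₁ ⊆ (⋂ l, S l) \ δ := hunion ▸ subset_union_left
  have hF₂sub : F₂ ⊆ (⋂ l, S l) \ δ := hunion ▸ subset_union_right
  have hF₁₂ : ∀ y, y ∈ F₁ → y ∉ F₂ := fun y h1 h2 => Set.disjoint_left.1 hdisj h1 h2
  have hF₂₁ : ∀ y, y ∈ F₂ → y ∉ F₁ := fun y h2 h1 => Set.disjoint_left.1 hdisj h1 h2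
  -- the indicator
  set χ : ↥(⋂ l, S l) → ℝ := fun y => if (y : X) ∈ F₁ then 1 else if (y : X) ∈ F₂ then -1 else 0
    with hχ
  have hχ₁ : ∀ y : ↥(⋂ l, S l), (y : X) ∈ F₁ → χ y = 1 := fun y hy => by simp only [hχ, hy, if_true]
  have hχ₂ : ∀ y : ↥(⋂ l, S l), (y : X) ∈ F₂ → χ y = -1 := fun y hy => by
    simp only [hχ, hy, hF₂₁ y hy, if_true, if_false]
  have hχδ : ∀ y : ↥(⋂ l, S l), (y : X) ∈ δ → χ y = 0 := fun y hy => by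
    have h1 : (y : X) ∉ F₁ := fun h' => (hF₁sub h').2 hy
    have h2 : (y : X) ∉ F₂ := fun h' => (hF₂sub h').2 hy
    simp only [hχ, h1, h2, if_false]
  have hχpm : ∀ y : ↥(⋂ l, S l), (y : X) ∉ δ → χ y = 1 ∨ χ y = -1 := fun y hy => by
    have : (y : X) ∈ F₁ ∪ F₂ := by rw [hunion]; exact ⟨y.2, hy⟩
    rcases this with h' | h'
    · exact Or.inl (hχ₁ y h')
    · exact Or.inr (hχ₂ y h')
  have hχloc : ∀ y : ↥(⋂ l, S l), (y : X) ∉ δ → ∀ᶠ z in 𝓝 y, χ z = χ y := fun y hy => by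
    have : (y : X) ∈ F₁ ∪ F₂ := by rw [hunion]; exact ⟨y.2, hy⟩
    rcases this with h' | h'
    · filter_upwards [hF₁o.mem_nhds h'] with z hz
      rw [hχ₁ z hz, hχ₁ y h']
    · filter_upwards [hF₂o.mem_nhds h'] with z hz
      rw [hχ₂ z hz, hχ₂ y h']
  -- the trace of `δ` on `F`
  set δF : Set ↥(⋂ l, S l) := Subtype.val ⁻¹' δ with hδFdef
  have himage : Subtype.val '' δF = δ := by
    ext y
    simp only [hδFdef, mem_image, mem_preimage]
    exact ⟨fun ⟨z, hz, hzy⟩ => hzy ▸ hz, fun hy => ⟨⟨y, hδF hy⟩, hy, rfl⟩⟩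
  have hδFconn : IsPreconnected δF := by
    rw [← Topology.IsInducing.subtypeVal.isPreconnected_image, himage]
    exact hc.isConnected.isPreconnected
  -- `δ` is nowhere dense in `F` (a local side is non-empty)
  have hnd : ∀ p ∈ δF, ∀ V ∈ 𝓝 p, (V \ δF).Nonempty := by
    intro p hp V hV
    obtain ⟨e, hpe, hep, hδe, -⟩ := hchart p hp
    obtain ⟨W, -, -, hWV, -, P₁, P₂, -, -, hP₁δ, -, -, -, -, hP₁ne, -, hP₁W, -⟩ :=
      exists_local_sides_of_flatChart' (δ := δF) e hpe hep hδe hV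
    obtain ⟨z, hz⟩ := hP₁ne
    exact ⟨z, hWV (hP₁W hz), hP₁δ hz⟩
  -- each preconnected subset of `F ∖ δ` lies in one side
  have hside : ∀ P : Set ↥(⋂ l, S l), IsPreconnected P → P ⊆ δFᶜ →
      (∀ y ∈ P, (y : X) ∈ F₁) ∨ (∀ y ∈ P, (y : X) ∈ F₂) := by
    intro P hPc hPδ
    have h1 : Subtype.val '' P ⊆ (⋂ l, S l) \ δ := by
      rintro _ ⟨z, hz, rfl⟩; exact ⟨z.2, hPδ hz⟩
    rcases hmax _ h1 (hPc.image _ continuous_subtype_val.continuousOn) with h' | h'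
    · exact Or.inl fun y hy => h' ⟨y, hy, rfl⟩
    · exact Or.inr fun y hy => h' ⟨y, hy, rfl⟩
  -- locally, `σ χ` is constant off `δ`
  have hlocτ : ∀ p ∈ δF, ∃ W ∈ 𝓝 p, ∃ κ : ℝ, ∀ y ∈ W \ δF, sd y * χ y = κ := by
    intro p hp
    obtain ⟨e, hpe, hep, hδe, ε, -, hsdε⟩ := hchart p hp
    obtain ⟨W, hWo, hpW, -, hWsrc, P₁, P₂, hP₁c, hP₂c, hP₁δ, hP₂δ, hWP, -, -, -, -, hP₁W, hP₂W,
      hP₁pos, hP₂neg⟩ := exists_local_sides_of_flatChart' (δ := δF) e hpe hep hδe univ_mem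
    -- the two half-boxes do not lie in the same side: `p` adheres to both sides
    have hboth : ∀ (Fi Fj : Set X), closure Fj = Fj ∪ δ → (∀ y, y ∈ Fi → y ∉ Fj) →
        Fj ⊆ (⋂ l, S l) \ δ → ¬ ((∀ y ∈ P₁, (y : X) ∈ Fi) ∧ (∀ y ∈ P₂, (y : X) ∈ Fi)) := by
      rintro Fi Fj hclj hij hFjsub ⟨h1, h2⟩
      obtain ⟨G, hGo, hGW⟩ := isOpen_induced_iff.1 hWo
      have hpG : (p : X) ∈ G := by
        have : p ∈ Subtype.val ⁻¹' G := by rw [hGW]; exact hpW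
        exact this
      have hpcl : (p : X) ∈ closure Fj := by rw [hclj]; exact Or.inr hp
      obtain ⟨z, hzG, hzFj⟩ := mem_closure_iff_nhds.1 hpcl G (hGo.mem_nhds hpG)
      have hzF : z ∈ ⋂ l, S l := (hFjsub hzFj).1
      have hzδ : z ∉ δ := (hFjsub hzFj).2
      have hzW : (⟨z, hzF⟩ : ↥(⋂ l, S l)) ∈ W := by
        have : (⟨z, hzF⟩ : ↥(⋂ l, S l)) ∈ Subtype.val ⁻¹' G := hzG
        rwa [hGW] at this
      rcases hWP ⟨hzW, hzδ⟩ with hz1 | hz2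
      · exact hij z (h1 _ hz1) hzFj
      · exact hij z (h2 _ hz2) hzFj
    refine ⟨W, hWo.mem_nhds hpW, ?_⟩
    rcases hside P₁ hP₁c hP₁δ with h1 | h1 <;> rcases hside P₂ hP₂c hP₂δ with h2 | h2
    · exact absurd ⟨h1, h2⟩ (hboth F₁ F₂ hcl₂ hF₁₂ hF₂sub)
    · refine ⟨ε, fun y hy => ?_⟩
      rcases hWP hy with hy1 | hy2
      · rw [(hsdε y (hWsrc (hP₁W hy1))).1 (hP₁pos y hy1), hχ₁ y (h1 y hy1), mul_one]
      · rw [(hsdε y (hWsrc (hP₂W hy2))).2 (hP₂neg y hy2), hχ₂ y (h2 y hy2)]; ring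
    · refine ⟨-ε, fun y hy => ?_⟩
      rcases hWP hy with hy1 | hy2
      · rw [(hsdε y (hWsrc (hP₁W hy1))).1 (hP₁pos y hy1), hχ₂ y (h1 y hy1)]; ring
      · rw [(hsdε y (hWsrc (hP₂W hy2))).2 (hP₂neg y hy2), hχ₁ y (h2 y hy2)]; ring
    · exact absurd ⟨h1, h2⟩ (hboth F₂ F₁ hcl₁ hF₂₁ hF₁sub)
  obtain ⟨A, hAo, hδA, κ, hκ⟩ := exists_open_forall_eq_of_local hδFconn hnd hlocτ
  -- the value of `κ` is `±1` (evaluate in a half-box at a point of `δ`)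
  obtain ⟨p₀, hp₀⟩ := hc.nonempty
  have hp₀F : (⟨p₀, hδF hp₀⟩ : ↥(⋂ l, S l)) ∈ δF := hp₀
  obtain ⟨e, hpe, hep, hδe, ε, hε, hsdε⟩ := hchart ⟨p₀, hδF hp₀⟩ hp₀
  obtain ⟨W, -, -, hWA, hWsrc, P₁, -, -, -, hP₁δ, -, -, -, -, hP₁ne, -, hP₁W, -, hP₁pos, -⟩ :=
    exists_local_sides_of_flatChart' (δ := δF) e hpe hep hδe (hAo.mem_nhds (hδA hp₀F))
  obtain ⟨z, hz⟩ := hP₁ne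
  have hzδ : (z : X) ∉ δ := hP₁δ hz
  have hκz : sd z * χ z = κ := hκ z ⟨hWA (hP₁W hz), hzδ⟩
  have hsdz : sd z = ε := (hsdε z (hWsrc (hP₁W hz))).1 (hP₁pos z hz)
  have hκ1 : κ = 1 ∨ κ = -1 := by
    rw [← hκz, hsdz]
    rcases hε with h' | h' <;> rcases hχpm z hzδ with h'' | h'' <;> norm_num [h', h'']
  refine ⟨χ, hχpm, hχδ, hχloc, A, hAo, hδA, κ, hκ1, fun y hyA hyδ => ?_⟩
  have hy := hκ y ⟨hyA, hyδ⟩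
  rcases hχpm y hyδ with h' | h'
  · rw [h', mul_one] at hy; rw [h', mul_one]; exact hy
  · rw [h'] at hy ⊢; linarith

end SideIndicator

/-! ### The disc separates the handlebody -/

section Disc

variable {X : Type u} [TopologicalSpace X] [T2Space X] [SecondCountableTopology X]
  [ChartedSpace (EuclideanSpace ℝ (Fin 4)) X] {g : ℕ} {k : Fin 3 → ℕ} {S : Fin 3 → Set X}

/-- **Functoriality of the winding character under restriction to a subspace**: for `A ⊆ B`,
a circle-valued `Θ` on `B` with restriction `c` to `A`, the winding character of `Θ` composed
with `(A ⊆ B)⁎` is the winding character of `c`. [folklore] -/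
theorem windingHom_comp_inclHomOfSubset {Y : Type*} [TopologicalSpace Y] {A B : Set Y}
    (hAB : A ⊆ B) {x : Y} (hA : x ∈ A) (hB : x ∈ B) (Θ : C(↥B, AddCircle (1 : ℝ)))
    (c : C(↥A, AddCircle (1 : ℝ))) (hc : Θ.comp (ContinuousMap.inclusion hAB) = c) :
    ((fundamentalGroupAddCircleEquiv one_ne_zero (Θ ⟨x, hB⟩)).toMonoidHom.comp
        (FundamentalGroup.map Θ ⟨x, hB⟩)).comp (inclHomOfSubset hAB x hA hB) =
      (fundamentalGroupAddCircleEquiv one_ne_zero (c ⟨x, hA⟩)).toMonoidHom.comp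
        (FundamentalGroup.map c ⟨x, hA⟩) := by
  subst hc
  rw [MonoidHom.comp_assoc, map_comp_inclHomOfSubset hAB hA hB Θ]
  rfl

/-- **A separating reducing curve has separating compressing discs.**  Let `S` be a Gay–Kirby
trisection of `X` with central surface `F = ⋂ l, S l` and handlebody
`H_q = Trisection.spineHandlebody S q`, `δ` a curve on `F` which is SEPARATING
(`¬ Trisection.IsNonSeparating S δ`), `D` closed with `D ∩ F = δ` (the compressing disc; that
`D ⊆ H_q` is not needed),
`O ⊇ D` open with a side function `σ = ±1` on `(O ∩ H_q) ∖ D`, locally constant relative to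
`H_q`, and flat charts of `(F, δ)` at the points of `δ` in which `σ` is `ε` above and `-ε` below
`δ`.  Then `H_q ∖ D` is not connected.  See the module docstring for the proof.
[cite: ArandaZupan2025, §2 p. 6 (separating reducing curves)]
[cite: MeierSchirmerZupan2016, §3 proof of Proposition 3.9]
[cite: HatcherAT2002, Thm. 1.7 (p. 29)] -/
theorem IsGKTrisection.not_isConnected_spineHandlebody_diff_of_sideCharts
    (h : IsGKTrisection X g k S) {δ : Set X} (hc : Trisection.IsCurve S δ)
    (hsep : ¬ Trisection.IsNonSeparating S δ) (q : Fin 3)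
    (D : Set X) (hDc : IsClosed D) (hDF : D ∩ (⋂ l, S l) = δ)
    (O : Set X) (hO : IsOpen O) (hDO : D ⊆ O) (sd : X → ℝ)
    (hsd : ∀ y ∈ (O ∩ Trisection.spineHandlebody S q) \ D,
      (sd y = 1 ∨ sd y = -1) ∧ ∀ᶠ z in 𝓝[Trisection.spineHandlebody S q] y, sd z = sd y)
    (hchart : ∀ p : ↥(⋂ l, S l), (p : X) ∈ δ →
      ∃ e : OpenPartialHomeomorph ↥(⋂ l, S l) (ℝ × ℝ), p ∈ e.source ∧ e p = 0 ∧
        (∀ y ∈ e.source, (y : X) ∈ δ ↔ (e y).2 = 0) ∧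
        ∃ ε : ℝ, (ε = 1 ∨ ε = -1) ∧ ∀ y ∈ e.source,
          (0 < (e y).2 → sd y = ε) ∧ ((e y).2 < 0 → sd y = -ε)) :
    ¬ IsConnected (Trisection.spineHandlebody S q \ D) := by
  classical
  intro hconn
  -- elementary set relations
  have hFH : (⋂ l, S l) ⊆ Trisection.spineHandlebody S q := iInter_subset_spineHandlebody S q
  have hHc : IsClosed (Trisection.spineHandlebody S q) := h.isClosed_spineHandlebody q
  have hFc : IsClosed (⋂ l, S l) := h.isCompact_iInter.isClosed
  haveI : CompactSpace X := h.compactSpace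
  have hδF : δ ⊆ (⋂ l, S l) := hc.1
  have hδD : δ ⊆ D := fun y hy => by
    have : y ∈ D ∩ (⋂ l, S l) := by rw [hDF]; exact hy
    exact this.1
  have hDne : D.Nonempty := hc.nonempty.mono hδD
  have hnotD : ∀ y ∈ (⋂ l, S l), y ∉ δ → y ∉ D := fun y hyF hyδ hyD => by
    have : y ∈ D ∩ (⋂ l, S l) := ⟨hyD, hyF⟩
    rw [hDF] at this
    exact hyδ this
  -- a metric
  haveI : TopologicalSpace.MetrizableSpace X := Manifold.metrizableSpace (𝓡 4) X
  letI : MetricSpace X := TopologicalSpace.metrizableSpaceMetric X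
  -- the normal coordinate `K = σ · infDist(·, D)`
  set K : X → ℝ := fun y => sd y * infDist y D with hK
  have hK0 : ∀ y ∈ D, K y = 0 := fun y hy => by
    simp only [hK, infDist_zero_of_mem hy, mul_zero]
  have hKabs : ∀ y ∈ O ∩ Trisection.spineHandlebody S q, |K y| ≤ infDist y D := fun y hy => by
    by_cases hyD : y ∈ D
    · rw [hK0 y hyD, abs_zero]; exact infDist_nonneg
    · obtain ⟨hv, -⟩ := hsd y ⟨hy, hyD⟩
      simp only [hK, abs_mul, abs_of_nonneg infDist_nonneg]
      rcases hv with h1 | h1 <;> simp [h1]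
  have hDpos : ∀ y, y ∉ D → 0 < infDist y D := fun y hyD =>
    (hDc.notMem_iff_infDist_pos hDne).1 hyD
  have hKne : ∀ y ∈ O ∩ Trisection.spineHandlebody S q, y ∉ D → K y ≠ 0 := fun y hy hyD => by
    obtain ⟨hv, -⟩ := hsd y ⟨hy, hyD⟩
    have hpos := hDpos y hyD
    rcases hv with h1 | h1 <;> simp [hK, h1, hpos.ne']
  -- continuity of `K` on `O ∩ H_q`, relative to `H_q`
  have hKcont : ContinuousOn K (O ∩ Trisection.spineHandlebody S q) := by
    intro y hy
    refine ContinuousWithinAt.mono ?_ inter_subset_right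
    by_cases hyD : y ∈ D
    · show Tendsto K (𝓝[(Trisection.spineHandlebody S q)] y) (𝓝 (K y))
      rw [hK0 y hyD, Metric.tendsto_nhds]
      intro ε hε
      have h1 : ∀ᶠ z in 𝓝[Trisection.spineHandlebody S q] y,
          z ∈ O ∩ Trisection.spineHandlebody S q :=
        Filter.inter_mem (mem_nhdsWithin_of_mem_nhds (hO.mem_nhds hy.1)) self_mem_nhdsWithin
      have h2 : ∀ᶠ z in 𝓝[(Trisection.spineHandlebody S q)] y, dist z y < ε :=
        mem_nhdsWithin_of_mem_nhds (Metric.ball_mem_nhds y hε)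
      filter_upwards [h1, h2] with z hz1 hz2
      rw [Real.dist_eq, sub_zero]
      exact lt_of_le_of_lt ((hKabs z hz1).trans (infDist_le_dist_of_mem hyD)) hz2
    · obtain ⟨-, hloc⟩ := hsd y ⟨hy, hyD⟩
      have h1 : ContinuousWithinAt (fun z => sd y * infDist z D)
          (Trisection.spineHandlebody S q) y :=
        (continuous_const.mul (continuous_infDist_pt _)).continuousWithinAt
      refine h1.congr_of_eventuallyEq ?_ ?_
      · filter_upwards [hloc] with z hz
        simp only [hK, hz]
      · simp only [hK]
  -- the side indicator `χ` on `F` and the sign `κ`: `σ = κ χ` near `δ`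
  obtain ⟨χ, hχpm, hχδ, hχloc, A, hAo, hδA, κ, hκ1, hκ⟩ :=
    h.exists_sideIndicator hc hsep (fun y => sd y) fun p hp => hchart p hp
  -- shrink `A` into `O`; an open `G` of `X` with trace `A'`
  set A' : Set ↥(⋂ l, S l) := A ∩ Subtype.val ⁻¹' O with hA'
  have hA'o : IsOpen A' := hAo.inter (hO.preimage continuous_subtype_val)
  have hδA' : ∀ y : ↥(⋂ l, S l), (y : X) ∈ δ → y ∈ A' := fun y hy => ⟨hδA hy, hDO (hδD hy)⟩
  obtain ⟨G, hGo, hGA⟩ := isOpen_induced_iff.1 hA'o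
  have hGA' : ∀ y : ↥(⋂ l, S l), (y : X) ∈ G ↔ y ∈ A' := fun y => by
    rw [← hGA]; rfl
  -- the global coordinate `K̃ = χ · infDist(·, D)` on `F`
  set KF : ↥(⋂ l, S l) → ℝ := fun y => χ y * infDist (y : X) D with hKF
  have hKF0 : ∀ y : ↥(⋂ l, S l), (y : X) ∈ δ → KF y = 0 := fun y hy => by
    simp only [hKF, infDist_zero_of_mem (hδD hy), mul_zero]
  have hKFabs : ∀ y : ↥(⋂ l, S l), |KF y| ≤ infDist (y : X) D := fun y => by
    have hχabs : |χ y| ≤ 1 := by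
      by_cases hyδ : (y : X) ∈ δ
      · rw [hχδ y hyδ, abs_zero]; exact zero_le_one
      · rcases hχpm y hyδ with h1 | h1 <;> simp [h1]
    calc |KF y| = |χ y| * infDist (y : X) D := by
          simp only [hKF, abs_mul, abs_of_nonneg infDist_nonneg]
      _ ≤ 1 * infDist (y : X) D := mul_le_mul_of_nonneg_right hχabs infDist_nonneg
      _ = infDist (y : X) D := one_mul _
  have hKFcont : Continuous KF := by
    rw [continuous_iff_continuousAt]
    intro y
    by_cases hyδ : (y : X) ∈ δ
    · rw [ContinuousAt, hKF0 y hyδ, Metric.tendsto_nhds]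
      intro ε hε
      have h2 : ∀ᶠ z in 𝓝 y, dist z y < ε := Metric.ball_mem_nhds y hε
      filter_upwards [h2] with z hz
      rw [Real.dist_eq, sub_zero]
      have hyD : (y : X) ∈ D := hδD hyδ
      calc |KF z| ≤ infDist (z : X) D := hKFabs z
        _ ≤ dist (z : X) y := infDist_le_dist_of_mem hyD
        _ < ε := hz
    · have h1 : ContinuousAt (fun z : ↥(⋂ l, S l) => χ y * infDist (z : X) D) y :=
        (continuous_const.mul ((continuous_infDist_pt D).comp continuous_subtype_val)).continuousAt
      refine h1.congr ?_
      filter_upwards [hχloc y hyδ] with z hz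
      simp only [hKF, hz]
  have hKFne : ∀ y : ↥(⋂ l, S l), (y : X) ∉ δ → KF y ≠ 0 := fun y hyδ => by
    have hpos := hDpos y (hnotD y y.2 hyδ)
    rcases hχpm y hyδ with h1 | h1 <;> simp [hKF, h1, hpos.ne']
  -- the sign relation `K · K̃ = κ · infDist²` on `A' ∖ δ`
  have hKKF : ∀ y ∈ A', (y : X) ∉ δ → K y * KF y = κ * infDist (y : X) D ^ 2 := by
    intro y hy hyδ
    have h1 : sd y = κ * χ y := hκ y hy.1 hyδ
    have hχsq : χ y * χ y = 1 := by
      rcases hχpm y hyδ with h2 | h2 <;> rw [h2] <;> norm_num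
    show sd y * infDist (y : X) D * (χ y * infDist (y : X) D) = κ * infDist (y : X) D ^ 2
    rw [h1]
    calc κ * χ y * infDist (y : X) D * (χ y * infDist (y : X) D)
        = κ * (χ y * χ y) * infDist (y : X) D ^ 2 := by ring
      _ = κ * infDist (y : X) D ^ 2 := by rw [hχsq, mul_one]
  -- the crossing arc, in a chart at a point of `δ`, inside `A'`
  obtain ⟨p₀, hp₀⟩ := hc.nonempty
  obtain ⟨e, hpe, hep, hδe, ε, hε1, hεsd⟩ := hchart ⟨p₀, hδF hp₀⟩ hp₀
  set T : Set (ℝ × ℝ) := e.target ∩ e.symm ⁻¹' A' with hT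
  have hTo : IsOpen T := e.continuousOn_symm.isOpen_inter_preimage e.open_target hA'o
  have h0T : (0 : ℝ × ℝ) ∈ T := by
    refine ⟨hep ▸ e.map_source hpe, ?_⟩
    show e.symm 0 ∈ A'
    rw [← hep, e.left_inv hpe]
    exact hδA' _ hp₀
  obtain ⟨r, hr, hball⟩ := Metric.isOpen_iff.1 hTo 0 h0T
  set z : I → ℝ × ℝ := fun s => ((0 : ℝ), ε * (r / 2) * (2 * (s : ℝ) - 1)) with hz
  have hzc : Continuous z :=
    continuous_const.prodMk (continuous_const.mul
      ((continuous_const.mul continuous_subtype_val).sub continuous_const))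
  have hεabs : |ε| = 1 := by rcases hε1 with h1 | h1 <;> simp [h1]
  have hzball : ∀ s, z s ∈ Metric.ball (0 : ℝ × ℝ) r := fun s => by
    rw [Metric.mem_ball, Prod.dist_eq, Real.dist_eq, Real.dist_eq]
    simp only [hz, Prod.fst_zero, Prod.snd_zero, sub_zero, abs_zero]
    refine max_lt hr ?_
    have hs : |2 * (s : ℝ) - 1| ≤ 1 := by
      rw [abs_le]; constructor <;> linarith [s.2.1, s.2.2]
    calc |ε * (r / 2) * (2 * (s : ℝ) - 1)| = r / 2 * |2 * (s : ℝ) - 1| := by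
          rw [abs_mul, abs_mul, hεabs, one_mul, abs_of_pos (by positivity)]
      _ ≤ r / 2 * 1 := by gcongr
      _ < r := by linarith
  have hzT : ∀ s, z s ∈ T := fun s => hball (hzball s)
  set α : Path (e.symm (z 0)) (e.symm (z 1)) :=
    { toFun := fun s => e.symm (z s)
      continuous_toFun := e.continuousOn_symm.comp_continuous hzc fun s => (hzT s).1
      source' := rfl
      target' := rfl } with hαdef
  have hα_apply : ∀ s, α s = e.symm (z s) := fun s => rfl
  have hαsrc : ∀ s, α s ∈ e.source := fun s => e.map_target (hzT s).1
  have heα : ∀ s, e (α s) = z s := fun s => e.right_inv (hzT s).1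
  have hαA' : ∀ s, α s ∈ A' := fun s => (hzT s).2
  set s₀ : I := ⟨1 / 2, by norm_num, by norm_num⟩ with hs₀def
  have hzs₀ : z s₀ = 0 := by
    simp only [hz, hs₀def]
    norm_num
  have hα₀ : (α s₀ : X) ∈ δ := by
    rw [hα_apply, hzs₀, ← hep, e.left_inv hpe]
    exact hp₀
  have hsecond : ∀ s : I, (e (α s)).2 = ε * (r / 2) * (2 * (s : ℝ) - 1) := fun s => by
    rw [heα]
  have hαneg : ∀ s, s < s₀ → (α s : X) ∉ δ ∧ sd (α s) = -1 := by
    intro s hs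
    have hs' : 2 * (s : ℝ) - 1 < 0 := by
      have : (s : ℝ) < 1 / 2 := hs
      linarith
    have hne : (e (α s)).2 ≠ 0 := by
      rw [hsecond]
      rcases hε1 with h1 | h1 <;> rw [h1] <;> nlinarith
    refine ⟨fun hδ' => hne ((hδe _ (hαsrc s)).1 hδ'), ?_⟩
    rcases hε1 with h1 | h1
    · have hlt : (e (α s)).2 < 0 := by rw [hsecond, h1]; nlinarith
      rw [(hεsd _ (hαsrc s)).2 hlt, h1]
    · have hgt : 0 < (e (α s)).2 := by rw [hsecond, h1]; nlinarith
      rw [(hεsd _ (hαsrc s)).1 hgt, h1]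
  have hαpos : ∀ s, s₀ < s → (α s : X) ∉ δ ∧ sd (α s) = 1 := by
    intro s hs
    have hs' : 0 < 2 * (s : ℝ) - 1 := by
      have : (1 / 2 : ℝ) < s := hs
      linarith
    have hne : (e (α s)).2 ≠ 0 := by
      rw [hsecond]
      rcases hε1 with h1 | h1 <;> rw [h1] <;> nlinarith
    refine ⟨fun hδ' => hne ((hδe _ (hαsrc s)).1 hδ'), ?_⟩
    rcases hε1 with h1 | h1
    · have hgt : 0 < (e (α s)).2 := by rw [hsecond, h1]; nlinarith
      rw [(hεsd _ (hαsrc s)).1 hgt, h1]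
    · have hlt : (e (α s)).2 < 0 := by rw [hsecond, h1]; nlinarith
      rw [(hεsd _ (hαsrc s)).2 hlt, h1]; norm_num
  -- the cut-off: `1` near `D ∪ α`, supported where `K` is controlled
  set Ncut : Set X := {x | x ∈ Trisection.spineHandlebody S q → x ∈ O} ∩
    {x | x ∈ (⋂ l, S l) → x ∈ G} with hNcut
  have hNo : IsOpen Ncut := by
    have h1 : IsOpen {x : X | x ∈ Trisection.spineHandlebody S q → x ∈ O} := by
      have : {x : X | x ∈ Trisection.spineHandlebody S q → x ∈ O} =
          (Trisection.spineHandlebody S q)ᶜ ∪ O := by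
        ext x; simp only [mem_setOf_eq, mem_union, mem_compl_iff, imp_iff_not_or]
      rw [this]
      exact hHc.isOpen_compl.union hO
    have h2 : IsOpen {x : X | x ∈ (⋂ l, S l) → x ∈ G} := by
      have : {x : X | x ∈ (⋂ l, S l) → x ∈ G} = (⋂ l, S l)ᶜ ∪ G := by
        ext x; simp only [mem_setOf_eq, mem_union, mem_compl_iff, imp_iff_not_or]
      rw [this]
      exact hFc.isOpen_compl.union hGo
    exact h1.inter h2
  set Pcut : Set X := D ∪ range (fun s => (α s : X)) with hPcut
  have hPc : IsClosed Pcut :=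
    hDc.union (isCompact_range (continuous_subtype_val.comp α.continuous)).isClosed
  have hPN : Pcut ⊆ Ncut := by
    rintro y (hyD | ⟨s, rfl⟩)
    · refine ⟨fun _ => hDO hyD, fun hyF => ?_⟩
      have hyδ : y ∈ δ := by rw [← hDF]; exact ⟨hyD, hyF⟩
      exact (hGA' ⟨y, hyF⟩).2 (hδA' _ hyδ)
    · exact ⟨fun _ => (hαA' s).2, fun _ => (hGA' (α s)).2 (hαA' s)⟩
  obtain ⟨ρ, hsupp, ⟨U1, -, hPU1, hρ1⟩, hρ01⟩ := exists_cutoff_nhdsSet hPc hNo hPN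
  -- the collapse `Θ` on `H_q`
  have hNq : IsOpen (Subtype.val ⁻¹' O : Set ↥(Trisection.spineHandlebody S q)) :=
    hO.preimage continuous_subtype_val
  have hKq : ContinuousOn (K ∘ Subtype.val)
      (Subtype.val ⁻¹' O : Set ↥(Trisection.spineHandlebody S q)) :=
    hKcont.comp continuous_subtype_val.continuousOn fun y hy => ⟨hy, y.2⟩
  have hKneq : ∀ y ∈ (Subtype.val ⁻¹' O : Set ↥(Trisection.spineHandlebody S q)),
      y ∉ (Subtype.val ⁻¹' D : Set ↥(Trisection.spineHandlebody S q)) →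
      (K ∘ Subtype.val) y ≠ 0 := fun y hy hyD => hKne y ⟨hy, y.2⟩ hyD
  have hK0q : ∀ y ∈ (Subtype.val ⁻¹' D : Set ↥(Trisection.spineHandlebody S q)),
      (K ∘ Subtype.val) y = 0 := fun y hy => hK0 y hy
  have hρq : Continuous (ρ ∘ (Subtype.val : ↥(Trisection.spineHandlebody S q) → X)) :=
    ρ.continuous.comp continuous_subtype_val
  have hsuppq : tsupport (ρ ∘ (Subtype.val : ↥(Trisection.spineHandlebody S q) → X)) ⊆
      Subtype.val ⁻¹' O := fun y hy =>
    (hsupp (tsupport_comp_subtype_val_subset ρ hy)).1 y.2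
  have hρPq : ∀ y ∈ (Subtype.val ⁻¹' D : Set ↥(Trisection.spineHandlebody S q)),
      (ρ ∘ Subtype.val) y ≠ 0 := fun y hy => by
    show ρ y.1 ≠ 0
    rw [hρ1 _ (hPU1 (Or.inl hy))]
    exact one_ne_zero
  set Θ : C(↥(Trisection.spineHandlebody S q), AddCircle (1 : ℝ)) :=
    circleCollapseMap hNq hKq hKneq hρq hsuppq hρPq with hΘ
  -- the loop in `H_q`: the arc, and a return path in the (path connected) `H_q ∖ D`
  haveI := h.locallyPathConnectedSpace_spineHandlebody q
  set ι : ↥(⋂ l, S l) → ↥(Trisection.spineHandlebody S q) := Set.inclusion hFH with hι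
  have hιc : Continuous ι := continuous_inclusion hFH
  set αH : Path (ι (α 0)) (ι (α 1)) := (α.map hιc).cast (by rw [α.source]) (by rw [α.target])
    with hαH
  have hαH_apply : ∀ s, αH s = ι (α s) := fun s => rfl
  have hopen : IsOpen ((Subtype.val ⁻¹' D : Set ↥(Trisection.spineHandlebody S q))ᶜ) :=
    (hDc.preimage continuous_subtype_val).isOpen_compl
  have hconn' : IsConnected ((Subtype.val ⁻¹' D : Set ↥(Trisection.spineHandlebody S q))ᶜ) := by
    have himg : Subtype.val '' ((Subtype.val ⁻¹' D : Set ↥(Trisection.spineHandlebody S q))ᶜ) =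
        Trisection.spineHandlebody S q \ D := by
      ext y
      constructor
      · rintro ⟨w, hw, rfl⟩; exact ⟨w.2, hw⟩
      · rintro ⟨hyH, hyD⟩; exact ⟨⟨y, hyH⟩, hyD, rfl⟩
    refine ⟨?_, ?_⟩
    · obtain ⟨y, hyH, hyD⟩ := hconn.1
      exact ⟨⟨y, hyH⟩, hyD⟩
    · rw [← Topology.IsInducing.subtypeVal.isPreconnected_image, himg]
      exact hconn.2
  have hpc : IsPathConnected ((Subtype.val ⁻¹' D : Set ↥(Trisection.spineHandlebody S q))ᶜ) :=
    hopen.isConnected_iff_isPathConnected.1 hconn'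
  have h0lt : (0 : I) < s₀ := Subtype.coe_lt_coe.1 (by norm_num [hs₀def])
  have hlt1 : s₀ < (1 : I) := Subtype.coe_lt_coe.1 (by norm_num [hs₀def])
  have ha : (α 0 : X) ∉ δ := (hαneg 0 h0lt).1
  have hb : (α 1 : X) ∉ δ := (hαpos 1 hlt1).1
  have haD : ι (α 0) ∈ (Subtype.val ⁻¹' D : Set ↥(Trisection.spineHandlebody S q))ᶜ :=
    hnotD _ (α 0).2 ha
  have hbD : ι (α 1) ∈ (Subtype.val ⁻¹' D : Set ↥(Trisection.spineHandlebody S q))ᶜ :=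
    hnotD _ (α 1).2 hb
  set β : Path (ι (α 1)) (ι (α 0)) := (hpc.joinedIn _ hbD _ haD).somePath with hβ
  have hβD : ∀ s, β s ∉ (Subtype.val ⁻¹' D : Set ↥(Trisection.spineHandlebody S q)) := fun s =>
    (hpc.joinedIn _ hbD _ haD).somePath_mem s
  -- the winding character of `Θ` is non-trivial on `[αH · β]`
  set V : Set ↥(Trisection.spineHandlebody S q) := Subtype.val ⁻¹' U1 ∩ Subtype.val ⁻¹' O
    with hV
  have hVN : V ⊆ Subtype.val ⁻¹' O := inter_subset_right
  have hV1 : ∀ y ∈ V, (ρ ∘ Subtype.val) y = 1 := fun y hy => hρ1 _ hy.1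
  have hαV : ∀ s, αH s ∈ V := fun s =>
    ⟨hPU1 (Or.inr ⟨s, rfl⟩), (hαA' s).2⟩
  have hα0' : (K ∘ Subtype.val) (αH s₀) = 0 := hK0 _ (hδD hα₀)
  have hαneg' : ∀ s, s < s₀ → (K ∘ Subtype.val) (αH s) < 0 := fun s hs => by
    obtain ⟨hsδ, hss⟩ := hαneg s hs
    have hpos := hDpos (α s) (hnotD _ (α s).2 hsδ)
    show sd (α s) * infDist ((α s : X)) D < 0
    rw [hss]; linarith
  have hαpos' : ∀ s, s₀ < s → 0 < (K ∘ Subtype.val) (αH s) := fun s hs => by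
    obtain ⟨hsδ, hss⟩ := hαpos s hs
    have hpos := hDpos (α s) (hnotD _ (α s).2 hsδ)
    show 0 < sd (α s) * infDist ((α s : X)) D
    rw [hss, one_mul]; exact hpos
  have hwind := (windingHom_circleCollapse_ne_one_of_arc_of_path hNq hKq hKneq hK0q hρq hsuppq
    hρPq hVN hV1 αH β hαV s₀ hα0' hαneg' hαpos' hβD).1
  -- the trace `c_F` of `Θ` on `F`
  have hNF : IsOpen (Subtype.val ⁻¹' G : Set ↥(⋂ l, S l)) := hGo.preimage continuous_subtype_val
  have hKF' : ContinuousOn (K ∘ Subtype.val) (Subtype.val ⁻¹' G : Set ↥(⋂ l, S l)) :=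
    hKcont.comp continuous_subtype_val.continuousOn fun y hy => ⟨((hGA' y).1 hy).2, hFH y.2⟩
  have hKneF : ∀ y ∈ (Subtype.val ⁻¹' G : Set ↥(⋂ l, S l)),
      y ∉ (Subtype.val ⁻¹' δ : Set ↥(⋂ l, S l)) → (K ∘ Subtype.val) y ≠ 0 := fun y hy hyδ =>
    hKne y ⟨((hGA' y).1 hy).2, hFH y.2⟩ (hnotD y y.2 hyδ)
  have hρF : Continuous (ρ ∘ (Subtype.val : ↥(⋂ l, S l) → X)) :=
    ρ.continuous.comp continuous_subtype_val
  have hsuppF : tsupport (ρ ∘ (Subtype.val : ↥(⋂ l, S l) → X)) ⊆ Subtype.val ⁻¹' G :=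
    fun y hy => (hsupp (tsupport_comp_subtype_val_subset ρ hy)).2 y.2
  have hρPF : ∀ y ∈ (Subtype.val ⁻¹' δ : Set ↥(⋂ l, S l)), (ρ ∘ Subtype.val) y ≠ 0 :=
      fun y hy => by
    show ρ y.1 ≠ 0
    rw [hρ1 _ (hPU1 (Or.inl (hδD hy)))]
    exact one_ne_zero
  set cF : C(↥(⋂ l, S l), AddCircle (1 : ℝ)) :=
    circleCollapseMap hNF hKF' hKneF hρF hsuppF hρPF with hcF
  have hΘc : Θ.comp (ContinuousMap.inclusion hFH) = cF := by
    ext y; rfl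
  -- its winding character at `a = α 0` is non-trivial (`π₁(F) → π₁(H_q)` is onto)
  set a : ↥(⋂ l, S l) := α 0 with ha_def
  have hsurj : Function.Surjective (inclHomOfSubset hFH (a : X) a.2 (hFH a.2)) :=
    (surjective_inclHomOfSubset_congr (Trisection.spineHandlebody_eq_inter S q).symm
      (iInter_subset_inter S q) hFH a.2).1 (h.surjective_inclHomOfSubset_handlebody q a.2)
  have hcomp := windingHom_comp_inclHomOfSubset hFH a.2 (hFH a.2) Θ cF hΘc
  have hwF : (fundamentalGroupAddCircleEquiv one_ne_zero (cF ⟨(a : X), a.2⟩)).toMonoidHom.comp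
      (FundamentalGroup.map cF ⟨(a : X), a.2⟩) ≠ 1 := by
    intro h1
    apply hwind
    refine MonoidHom.ext fun x => ?_
    obtain ⟨y, rfl⟩ := hsurj x
    have h2 := DFunLike.congr_fun hcomp y
    rw [h1, MonoidHom.one_apply, MonoidHom.comp_apply] at h2
    rw [MonoidHom.one_apply]
    exact h2
  -- but on `F` the normal coordinate has the sign of `κ · K̃`, `K̃` continuous on all of `F`
  have hρF0 : ∀ y : ↥(⋂ l, S l), 0 ≤ (ρ ∘ Subtype.val) y := fun y => (hρ01 y).1
  apply hwF
  rcases hκ1 with hκp | hκn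
  · have hsign : ∀ y ∈ (Subtype.val ⁻¹' G : Set ↥(⋂ l, S l)),
        y ∉ (Subtype.val ⁻¹' δ : Set ↥(⋂ l, S l)) → 0 < (K ∘ Subtype.val) y * KF y := by
      intro y hy hyδ
      show 0 < K y * KF y
      rw [hKKF y ((hGA' y).1 hy) hyδ, hκp, one_mul]
      exact pow_pos (hDpos y (hnotD y y.2 hyδ)) 2
    have hker := ker_windingHom_circleCollapse_eq hNF hKF' hKFcont.continuousOn hsign hρF hsuppF
      hρPF ⟨(a : X), a.2⟩
    have hone := windingHom_circleCollapseMap_eq_one_of_continuous hNF hKFcont.continuousOn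
      (ne_zero_right_of_mul_pos hsign) hρF hsuppF hρPF hKFcont (fun y hy => hKFne y hy) hρF0
      ⟨(a : X), a.2⟩
    rw [← MonoidHom.ker_eq_top_iff] at hone ⊢
    exact hker.trans hone
  · have hsign : ∀ y ∈ (Subtype.val ⁻¹' G : Set ↥(⋂ l, S l)),
        y ∉ (Subtype.val ⁻¹' δ : Set ↥(⋂ l, S l)) → (K ∘ Subtype.val) y * KF y < 0 := by
      intro y hy hyδ
      show K y * KF y < 0
      rw [hKKF y ((hGA' y).1 hy) hyδ, hκn, neg_one_mul, neg_lt_zero]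
      exact pow_pos (hDpos y (hnotD y y.2 hyδ)) 2
    have hker := ker_windingHom_circleCollapse_eq_of_neg hNF hKF' hKFcont.continuousOn hsign hρF
      hsuppF hρPF ⟨(a : X), a.2⟩
    have hone := windingHom_circleCollapseMap_eq_one_of_continuous hNF hKFcont.continuousOn
      (ne_zero_right_of_mul_neg hsign) hρF hsuppF hρPF hKFcont (fun y hy => hKFne y hy) hρF0
      ⟨(a : X), a.2⟩
    rw [← MonoidHom.ker_eq_top_iff] at hone ⊢
    exact hker.trans hone

end Disc


end Literature.Topology.FourManifolds

end
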